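import Summits.AtomisticToContinuum.HydrodynamicLimit.Theses.ResponseRigidity
import Literature.MathematicalPhysics.KineticTheory.HardSphereEulerProofs
import HarnessLib

/-!
# Birth skeleton (BC3) for crux `CLTScaleConcentration` — item stmt-AtomisticToContinuum-15325,
# route `ResponseRigidity` (rank 3), sub-problem `HydrodynamicLimit`

Crux BY NAME: `Summit.AtomisticToContinuum.HydrodynamicLimit.Theses.ResponseRigidity.CLTScaleConcentration`
(C2 of the route): along every Euler activity family `LG_τ = localGibbsLaw σ (a τ) (u τ) (θ τ)`, for every
`t < T` and every smooth `χ` there is ONE constant `C` with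
`Var_{LG_τ}(⟨U_N(Φ_s ·), χ⟩) ≤ C/(N+1)` (centred square integrable) for the three tested conserved fields
(density, momentum coordinates, energy), all `N` and all `0 ≤ s, τ`, `s + τ ≤ t` — CLT-scale concentration of
the Euler-time conserved fields around their UNIDENTIFIED means.

## The cut: CUMULANT SPLIT (one-body second moments + pair covariances of the evolved law)

Every tested conserved field is a LABEL AVERAGE of a one-body observable of the evolved configuration,
`F(z) = (N+1)⁻¹ ∑ₖ g(zₖ(s))`, `g ∈ {χ(x), χ(x)vⱼ, χ(x)|v|²/2}` (`empirical*Field_eq_sum`), so EXACTLY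
`(N+1)² Var F = ∑ₖ Var g(zₖ(s)) + ∑_{i ≠ k} Cov(g(zᵢ(s)), g(zₖ(s)))`.
C2 is therefore the conjunction of a ONE-BODY statement and a TWO-BODY statement about the law
`P_s = (Φ_s)_# LG_τ` of the evolved gas, and the skeleton registers exactly these two:

* `stub_oneBodyMoments` — **label-summed one-body second moments are `O(N)`.** Same frame as C2; for
  `(N, s, τ, g)`: every `g(zₖ(s))` is `LG_τ`-integrable with integrable centred square, and
  `∑ₖ ∫ (g(zₖ(s)) − ∫ g(zₖ(s)))² dLG_τ ≤ C₁ (N+1)`. Content by field: density — trivial (`χ` continuous on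
  `𝕋³`, bounded); momentum — `∑ₖ E|vₖ(s)|² = ∑ₖ E|vₖ(0)|²` by conservation of kinetic energy along hard-sphere
  trajectories on the good set (`LG_τ ≪` Liouville) and the static Gaussian second moments of the local
  Maxwellians, uniformly in `τ ∈ [0, t]` (provable now, size M); energy — `∑ₖ E|vₖ(s)|⁴ ≤ C(N+1)`, a FOURTH
  velocity moment of the EVOLVED law averaged over labels: not a consequence of the conservation laws
  (`∑ₖ|vₖ|⁴ ≤ (∑ₖ|vₖ|²)²` only gives `O(N²)`) nor of the `O(N)` relative entropy w.r.t. the invariant Gibbs law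
  (entropy `O(N)` can buy one sphere of speed `N^{1/2}`); it is the polynomial, label-averaged shadow of
  Nachtergaele–Yau's high-momentum cutoff II.1, in the tree the OPEN hypothesis
  `Literature.Barriers.AtomisticToContinuum.HighMomentumCutoff σ` (exponential velocity moments along the
  evolution), which implies it. Static (s = 0) and, at constant profiles, for all `s` by invariance of the
  canonical Gibbs law. Size: M (density, momentum) + open-shallow (energy).
* `stub_pairCumulant` — **pair covariances of the evolved one-body observables are `O(1/N)` for every
  labelled pair (the hardest stub; open for `s > 0` off equilibrium).** Same frame; for `(N, s, τ, g)` and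
  every `i ≠ k`: the centred product is integrable and
  `|∫ (g(zᵢ(s)) − ∫g(zᵢ(s)))(g(zₖ(s)) − ∫g(zₖ(s))) dLG_τ| ≤ C₂/(N+1)` — the SECOND CUMULANT of the evolved law,
  tested against `g ⊗ g`, is of CLT size. At `s = 0` it is statics: the truncated pair correlation of the
  canonical low-density inhomogeneous hard-sphere law is the `O(1/N)` canonical-constraint term plus a
  connected part living on the microscopic correlation volume `ε_N³ = σ³/(N+1)` (PulvirentiTsagkarogiannis2015: `O(1/|Λ|)` finite-volume
  corrections and decay of the canonical truncated two-point correlation, on the canonical cluster expansion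
  PulvirentiTsagkarogiannis2012 Thm 2.1 — to be run with inhomogeneous activity; Ruelle1969 §4.2); at constant profiles it
  holds for all `s` by invariance; for `s > 0` off equilibrium it is the fixed-packing, Euler-time analogue of the
  `j = 2` CORRELATION ERROR bounds of Pulvirenti–Simonella (PulvirentiSimonella2016, Boltzmann–Grad, short times)
  and of the dynamical cumulant expansion of Bodineau–Gallagher–Saint-Raymond–Simonella (BGSSAnnals2023 §2,
  second cumulant `f₂^ε − f₁^ε ⊗ f₁^ε = O(μ_ε⁻¹)`), whose hierarchy for EMPIRICAL marginals is
  PulvirentiSimonella2015 Thm 1; physically it is boundedness of the Euler-scale covariance of the fluctuation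
  field transported by linearised Euler before the shock (Spohn1991 §7.1). Why it might fail: exactly C2's
  risk (an Euler-background instability / hidden slow pair mode producing pair correlations `≫ 1/N` at some
  `s ≥ δ`), plus one typing point: the PER-PAIR form presumes label-exchangeability of `(Φ_s)_# LG_τ`
  (symmetric canonical density, relabelling-equivariance of the hard-sphere flow Liouville-a.e.) — true for the
  dynamics, a technical lemma in Lean.

WHY THIS CURRENCY IS EASIER / MORE USEFUL THAN C2 ITSELF. (i) It separates the two mechanisms C2 mixes: the
one-body velocity-tail issue (where `HighMomentumCutoffBarrier` bites, and only for the energy field) from the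
genuinely two-body decorrelation; either can now be attacked, or refuted, alone. (ii) The pair stub is a statement
about the TWO-PARTICLE (empirical) marginal of the evolved law — the object of the BBGKY / cumulant hierarchies
(tree: `Literature.Analysis.FluidPDE.BBGKYMarginals`, `correlationFn`), for which expansion techniques exist
(Pulvirenti–Simonella, BGSS) — whereas the N-body variance is not addressed by any hierarchy directly. (iii) It is
the route's own idiom: the conditional version of `Cov(g(zᵢ(s)), g(zₖ(s)))` under `LG_τ` is the two-sphere
response `μ₂` of `SlavedContactSynergy`/`RigidityTransfer`; a prover of the engine handles the same tagged-pair
objects. Conversely, given `stub_oneBodyMoments` and exchangeability, C2 ⟹ `stub_pairCumulant`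
(`Cov_pair = ((N+1)² Var F − ∑ₖ Varₖ)/((N+1)N)`), so the line loses nothing.

Composition `CLTScaleConcentration_of : <stub₁-sig> → <stub₂-sig> → CLTScaleConcentration` is a real proof (no
`sorry` of its own): thresholds `η := min η₁ η₂`, `σ₀ := min σ₁ σ₂`, `C := |C₁| + |C₂|`; for `(N, s, τ, F)`
recognise `F` as the label average of `g` (`empiricalDensityField_eq_sum`, `empiricalMomentumField_eq_sum`,
`empiricalEnergyField_eq_sum`) and apply the sorry-free second-moment expansion `variance_avg_le`
(`(N+1)²(F − ∫F)² = diagonal + off-diagonal` pointwise, `integral_finsetSum`, `(N+1)·N` pair terms each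
`≤ |C₂|/(N+1)`). `CLTScaleConcentration_of_stubs : CLTScaleConcentration` is the same BY NAME from the two stubs.

## BC3 probes (folder `bc/` of the registrar session 2026-08-17; all FAIL as required — no stub is cheaply the
## crux or the summit)
`stub_oneBodyMoments → CLTScaleConcentration`, `stub_oneBodyMoments → _root_.HydrodynamicLimit`,
`stub_pairCumulant → CLTScaleConcentration`, `stub_pairCumulant → _root_.HydrodynamicLimit`, each by
`first | exact? | simpa [S] | (unfold S; simpa) | aesop` under `maxHeartbeats 400000`: rc 1 (heartbeat timeout at
`whnf`); single tactics: `exact?` alone "could not close the goal" (×4), `unfold S; aesop` simp-normalisation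
timeout (×4); dedup `example : S := by unfold S; exact?` fails for both stubs. `stub_oneBodyMoments` alone cannot
give C2 (no decorrelation), `stub_pairCumulant` alone cannot (no diagonal / integrability of the one-body terms),
and neither mentions `TendstoHydroFieldsAt` at `t > 0`.

## Disproof used / negatives / typing checklist
No `Cruxes/CLTScaleConcentration/Disproof.lean` exists (no `_false_without_` theorem, no landed
`Theorems/CLTScaleConcentration/Negative/*`; `ledger crux ls`: no workfiles before this one).
`ledger negatives --problem AtomisticToContinuum` (20 entries, 2026-08-17): none concerns variances, one-body moments
or pair covariances of evolved one-body observables under local Gibbs laws; nearest stmt-13733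
(`EquilibriumClampedCollisionalWindowLD`, refuted-misstated: frozen line-lattice witness) is a large-deviation
bound for a clamped two-body COLLISION-SUM functional — neither stub counts collisions. Typing checklist 4c:
(ii) Bochner — both stubs CONJOIN the integrability of every integrand whose integral they bound (no junk-`0`
satisfaction); (iv) no hand-picked thresholds — `C₁`, `C₂` existential after `(t, χ)`, `η`, `σ₀` as in C2.
Refuter's read-back of C2 (item notes 2026-08-16) is respected: `∀ N` (not eventually) is kept in both stubs — for
fixed `N` both quantities are finite and `O(1)` uniformly in `s, τ`.

## Dead lines avoided / cuts not taken (registrar NOTES.md)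
First skeleton on this crux (no dead lines). Not taken: "statics + propagation" (`S ∧ (S → C2)`: the propagation
stub is C2 minus a known lemma — a modus-ponens seam, same verdict as the `FieldVarianceBound` registrar);
Efron–Stein / one-sphere influence (`Var ≤ ∑ᵢ E Varᵢ` is useless for a chaotic flow: the resampling influence of
one sphere on `Y_s` saturates at the fluctuation scale after `O(N^{-1/3} log N)` macroscopic time, so the bound is
`O(1)`, not `O(1/N)`); sub-Gaussian MGF + extraction (the line already registered on the sibling crux
`VitaliAmplitudeTransfer.FieldVarianceBound` — not duplicated here); relative entropy at the CLT scale
(Jara–Menezes style: at fixed packing the Knudsen corrections `O(N^{-1/3})` to the means make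
`H(Φ_s#LG_τ | LG_{τ+s}) ≍ N^{1/3}`, not `O(1)`); tagged-particle covariance `Cov(F, g(zₖ(s))) = O(1/N)` (equals
`Var F` by exchangeability — a costume of C2).
-/

noncomputable section

namespace Summit.AtomisticToContinuum.HydrodynamicLimit.Cruxes.CLTScaleConcentration.Birth

open MeasureTheory Filter Set Topology
open scoped BigOperators
open Literature.MathematicalPhysics.KineticTheory Literature.Analysis.FluidPDE

/-! ## The stubs -/

/-- **Stub 1 (`stub_oneBodyMoments`): label-summed one-body second moments of the evolved conserved
observables are `O(N)`.** Frame = the frame of `CLTScaleConcentration` verbatim; conclusion: for `(t, χ)` there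
is `C₁` such that for all `N`, `0 ≤ s, τ`, `s + τ ≤ t`, `P = localGibbsLaw σ (a τ) (u τ) (θ τ) N (Φ N)` and
`g ∈ {χ(x), χ(x)vⱼ, χ(x)|v|²/2}`: each `z ↦ g((Φ_s z)ₖ)` is `P`-integrable with `P`-integrable centred square,
and `∑ₖ ∫ (g((Φ_s z)ₖ) − ∫ g((Φ_s w)ₖ) dP)² dP ≤ C₁ (N+1)`. Why plausibly true: density — `χ` bounded;
momentum — conservation of `∑ₖ|vₖ|²` on the good set + Gaussian second moments of the local Maxwellians
(profiles continuous, `θ` bounded on `[0,t] × 𝕋³`); energy — label-averaged FOURTH velocity moment of the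
evolved law, implied by the open `Literature.Barriers.AtomisticToContinuum.HighMomentumCutoff σ`
(NachtergaeleYau2003 II.1 transcription), static at `s = 0`, invariant at constant profiles. Why it might fail:
only through the energy field — kinetic energy concentrating on `o(N)` spheres in `L²` along the deterministic
evolution (the event the high-momentum cutoff excludes). Size: M (density, momentum; provable now) +
open-shallow (energy). Leans on: `localGibbsLaw`, `HardSphereFlow` (`isTrajectory`, `measure_compl_good`),
`isProbabilityMeasure_localGibbsLaw`, `HardSphereEulerProofs` (Gaussian velocity moments), NachtergaeleYau2003,
Spohn1991. -/
theorem stub_oneBodyMoments :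
    open Literature.MathematicalPhysics.KineticTheory Literature.Analysis.FluidPDE in ∃ η : ℝ, 0 < η ∧ ∀ (a₀ θ₀ : T3 → ℝ) (u₀ : T3 → V3), Continuous a₀ → Continuous θ₀ → Continuous u₀ → (∀ x, 0 < a₀ x) → (∀ x, 0 < θ₀ x) → ∃ σ₀ : ℝ, 0 < σ₀ ∧ ∀ σ : ℝ, 0 < σ → σ < σ₀ → ∀ (T : ℝ) (ρ θ : ℝ → T3 → ℝ) (u : ℝ → T3 → V3), IsHardSphereEulerSolution σ T ρ u θ → (∀ t ∈ Set.Ico 0 T, ∀ x, ρ t x * σ ^ 3 < η) → ∀ Φ : (N : ℕ) → HardSphereFlow (Torus.geometry (Fin 3)) (hsDiameter σ N) (N + 1), TendstoHydroFieldsAt (fun N => localGibbsLaw σ a₀ u₀ θ₀ N (Φ N)) Φ ρ u θ 0 → ∀ a : ℝ → T3 → ℝ, a 0 = a₀ → (∀ τ ∈ Set.Ico 0 T, Continuous (a τ) ∧ ∀ x, 0 < a τ x) → (∀ τ ∈ Set.Ico 0 T, ∀ χ : T3 → ℝ, Literature.Analysis.FunctionSpaces.Torus.IsSmooth χ → Tendsto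 (fun N : ℕ => ∫ z, empiricalDensityField z χ ∂(localGibbsLaw σ (a τ) (u τ) (θ τ) N (Φ N))) atTop (𝓝 (∫ x, χ x * ρ τ x)) ∧ (∀ j : Fin 3, Tendsto (fun N : ℕ => ∫ z, empiricalMomentumField z χ j ∂(localGibbsLaw σ (a τ) (u τ) (θ τ) N (Φ N))) atTop (𝓝 (∫ x, χ x * ρ τ x * u τ x j))) ∧ Tendsto (fun N : ℕ => ∫ z, empiricalEnergyField z χ ∂(localGibbsLaw σ (a τ) (u τ) (θ τ) N (Φ N))) atTop (𝓝 (∫ x, χ x * totalEnergyDensity (ρ τ x) (u τ x) (θ τ x)))) → ∀ t ∈ Set.Ico 0 T, ∀ χ : T3 → ℝ, Literature.Analysis.FunctionSpaces.Torus.IsSmooth χ → ∃ C₁ : ℝ, ∀ N : ℕ, ∀ s τ : ℝ, 0 ≤ s → 0 ≤ τ → s + τ ≤ t → let P : Measure (Config (N + 1) (Fin 3) T3) := localGibbsLaw σ (a τ) (u τ) (θ τ) N (Φ N); ∀ g : T3 × V3 → ℝ, ((g = fun y => χ y.1) ∨ (∃ j : Fin 3, g = fun y => χ y.1 * y.2 j)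 ∨ (g = fun y => χ y.1 * (‖y.2‖ ^ 2 / 2))) → (∀ k : Fin (N + 1), Integrable (fun z => g ((Φ N).flow s z k)) P ∧ Integrable (fun z => (g ((Φ N).flow s z k) - ∫ w, g ((Φ N).flow s w k) ∂P) ^ 2) P) ∧ ∑ k : Fin (N + 1), ∫ z, (g ((Φ N).flow s z k) - ∫ w, g ((Φ N).flow s w k) ∂P) ^ 2 ∂P ≤ C₁ * ((N : ℝ) + 1) := by
  sorry

/-- **Stub 2 (`stub_pairCumulant`, the hardest): pair covariances of the evolved one-body conserved
observables are `O(1/N)` for every labelled pair — the second cumulant of the evolved law is of CLT size.**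
Frame = the frame of `CLTScaleConcentration` verbatim; conclusion: for `(t, χ)` there is `C₂` such that for all
`N`, `0 ≤ s, τ`, `s + τ ≤ t`, `P = localGibbsLaw σ (a τ) (u τ) (θ τ) N (Φ N)`, `g ∈ {χ(x), χ(x)vⱼ, χ(x)|v|²/2}`
and all labels `i ≠ k`: the centred product `(g((Φ_s z)ᵢ) − ∫g((Φ_s ·)ᵢ))(g((Φ_s z)ₖ) − ∫g((Φ_s ·)ₖ))` is
`P`-integrable and its integral is at most `C₂/(N+1)` in absolute value. Why plausibly true: at `s = 0` it is
the truncated pair correlation of the canonical low-density hard-sphere law (canonical constraint `O(1/N)` +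
connected part on the correlation volume `σ³/(N+1)`; PulvirentiTsagkarogiannis2015 — finite-volume `O(1/|Λ|)` corrections and
decay of the canonical truncated two-point correlation — on the canonical cluster expansion PulvirentiTsagkarogiannis2012
Thm 2.1, to be run with inhomogeneous activity; Ruelle1969 §4.2);
at constant profiles for all `s` by invariance of the canonical Gibbs law; for `s > 0` pre-shock it is the
fixed-packing Euler-time analogue of the `j = 2` correlation-error / dynamical-cumulant bounds
(PulvirentiSimonella2016; BGSSAnnals2023 §2; hierarchy for empirical marginals PulvirentiSimonella2015 Thm 1) and
the finite-`N` form of "Euler-scale fluctuations have bounded covariance, transported by linearised Euler"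
(Spohn1991 §7). Why it might fail: an Euler-background instability or hidden slow pair mode giving pair
correlations `≫ 1/N` at some `s ≥ δ` (the risk of C2 itself); per-pair form presumes exchangeability of
`(Φ_s)_# LG_τ` (true a.e.; technical). Size: open problem (`s > 0` off equilibrium); L at `s = 0`. Leans on:
`localGibbsLaw`, `canonicalDensity`, `HardSphereFlow`, `Literature.Analysis.FluidPDE.BBGKYMarginals`
(`correlationFn`), PulvirentiTsagkarogiannis2015, PulvirentiTsagkarogiannis2012, PulvirentiSimonella2016, BGSSAnnals2023,
Spohn1991. -/
theorem stub_pairCumulant :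
    open Literature.MathematicalPhysics.KineticTheory Literature.Analysis.FluidPDE in ∃ η : ℝ, 0 < η ∧ ∀ (a₀ θ₀ : T3 → ℝ) (u₀ : T3 → V3), Continuous a₀ → Continuous θ₀ → Continuous u₀ → (∀ x, 0 < a₀ x) → (∀ x, 0 < θ₀ x) → ∃ σ₀ : ℝ, 0 < σ₀ ∧ ∀ σ : ℝ, 0 < σ → σ < σ₀ → ∀ (T : ℝ) (ρ θ : ℝ → T3 → ℝ) (u : ℝ → T3 → V3), IsHardSphereEulerSolution σ T ρ u θ → (∀ t ∈ Set.Ico 0 T, ∀ x, ρ t x * σ ^ 3 < η) → ∀ Φ : (N : ℕ) → HardSphereFlow (Torus.geometry (Fin 3)) (hsDiameter σ N) (N + 1), TendstoHydroFieldsAt (fun N => localGibbsLaw σ a₀ u₀ θ₀ N (Φ N)) Φ ρ u θ 0 → ∀ a : ℝ → T3 → ℝ, a 0 = a₀ → (∀ τ ∈ Set.Ico 0 T, Continuous (a τ) ∧ ∀ x, 0 < a τ x) → (∀ τ ∈ Set.Ico 0 T, ∀ χ : T3 → ℝ, Literature.Analysis.FunctionSpaces.Torus.IsSmooth χ → Tendsto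 (fun N : ℕ => ∫ z, empiricalDensityField z χ ∂(localGibbsLaw σ (a τ) (u τ) (θ τ) N (Φ N))) atTop (𝓝 (∫ x, χ x * ρ τ x)) ∧ (∀ j : Fin 3, Tendsto (fun N : ℕ => ∫ z, empiricalMomentumField z χ j ∂(localGibbsLaw σ (a τ) (u τ) (θ τ) N (Φ N))) atTop (𝓝 (∫ x, χ x * ρ τ x * u τ x j))) ∧ Tendsto (fun N : ℕ => ∫ z, empiricalEnergyField z χ ∂(localGibbsLaw σ (a τ) (u τ) (θ τ) N (Φ N))) atTop (𝓝 (∫ x, χ x * totalEnergyDensity (ρ τ x) (u τ x) (θ τ x)))) → ∀ t ∈ Set.Ico 0 T, ∀ χ : T3 → ℝ, Literature.Analysis.FunctionSpaces.Torus.IsSmooth χ → ∃ C₂ : ℝ, ∀ N : ℕ, ∀ s τ : ℝ, 0 ≤ s → 0 ≤ τ → s + τ ≤ t → let P : Measure (Config (N + 1) (Fin 3) T3) := localGibbsLaw σ (a τ) (u τ) (θ τ) N (Φ N); ∀ g : T3 × V3 → ℝ, ((g = fun y => χ y.1) ∨ (∃ j : Fin 3, g = fun y => χ y.1 * y.2 j)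 ∨ (g = fun y => χ y.1 * (‖y.2‖ ^ 2 / 2))) → ∀ i k : Fin (N + 1), i ≠ k → Integrable (fun z => (g ((Φ N).flow s z i) - ∫ w, g ((Φ N).flow s w i) ∂P) * (g ((Φ N).flow s z k) - ∫ w, g ((Φ N).flow s w k) ∂P)) P ∧ |∫ z, (g ((Φ N).flow s z i) - ∫ w, g ((Φ N).flow s w i) ∂P) * (g ((Φ N).flow s z k) - ∫ w, g ((Φ N).flow s w k) ∂P) ∂P| ≤ C₂ / ((N : ℝ) + 1) := by
  sorry

/-! ## Sorry-free lemmas for the composition -/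

/-- Square of a finite sum = diagonal + off-diagonal part:
`(∑ᵢ xᵢ)² = ∑ᵢ xᵢ² + ∑ᵢ ∑_{k ≠ i} xᵢ xₖ`. [folklore] -/
theorem sq_sum_eq_diag_add_offDiag {ι : Type*} [Fintype ι] [DecidableEq ι] (x : ι → ℝ) :
    (∑ i, x i) ^ 2 = ∑ i, x i ^ 2 + ∑ i, ∑ k ∈ Finset.univ.erase i, x i * x k := by
  rw [sq, Finset.sum_mul_sum, ← Finset.sum_add_distrib]
  refine Finset.sum_congr rfl fun i _ => ?_
  rw [← Finset.add_sum_erase _ _ (Finset.mem_univ i), sq]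

/-- Coordinates of the empirical momentum field as a label average:
`(m_w[χ])ⱼ = n⁻¹ ∑ᵢ χ(xᵢ) vᵢⱼ` (cf. `empiricalMomentumField_eq_sum`). [folklore] -/
theorem empiricalMomentumField_apply_eq_avg {n : ℕ} (w : Config n (Fin 3) T3) (χ : T3 → ℝ)
    (j : Fin 3) : empiricalMomentumField w χ j = (n : ℝ)⁻¹ * ∑ i, χ (w i).1 * (w i).2 j := by
  rw [empiricalMomentumField_eq_sum]
  simp only [PiLp.smul_apply, WithLp.ofLp_sum, Finset.sum_apply, smul_eq_mul, WithLp.ofLp_smul,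
    Pi.smul_apply]

/-- **Variance of a label average from one-body second moments and pair covariances**
(the second-moment expansion behind the composition; pure measure theory, any measure).
For `G₀, …, G_N : Ω → ℝ` integrable with integrable centred squares, label-summed centred
second moments `≤ A·(N+1)`, and for every labelled pair `i ≠ k` an integrable centred product with
`|∫ (Gᵢ − ∫Gᵢ)(Gₖ − ∫Gₖ)| ≤ B/(N+1)`, the average `F = (N+1)⁻¹ ∑ₖ Gₖ` has an integrable centred
square and `∫ (F − ∫F)² ≤ (|A| + |B|)/(N+1)`:
`(N+1)²(F − ∫F)² = ∑ₖ (Gₖ − ∫Gₖ)² + ∑ᵢ ∑_{k≠i} (Gᵢ − ∫Gᵢ)(Gₖ − ∫Gₖ)` pointwise, integrate. [folklore] -/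
theorem variance_avg_le {Ω : Type*} [MeasurableSpace Ω] (P : Measure Ω) {N : ℕ}
    (G : Fin (N + 1) → Ω → ℝ) (A B : ℝ)
    (hint : ∀ k, Integrable (G k) P)
    (hsq : ∀ k, Integrable (fun z => (G k z - ∫ w, G k w ∂P) ^ 2) P)
    (hdiag : ∑ k, ∫ z, (G k z - ∫ w, G k w ∂P) ^ 2 ∂P ≤ A * ((N : ℝ) + 1))
    (hprod : ∀ i k, i ≠ k →
      Integrable (fun z => (G i z - ∫ w, G i w ∂P) * (G k z - ∫ w, G k w ∂P)) P)
    (hcov : ∀ i k, i ≠ k →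
      |∫ z, (G i z - ∫ w, G i w ∂P) * (G k z - ∫ w, G k w ∂P) ∂P| ≤ B / ((N : ℝ) + 1)) :
    Integrable (fun z =>
        (((N : ℝ) + 1)⁻¹ * ∑ k, G k z - ∫ w, ((N : ℝ) + 1)⁻¹ * ∑ k, G k w ∂P) ^ 2) P ∧
      ∫ z, (((N : ℝ) + 1)⁻¹ * ∑ k, G k z - ∫ w, ((N : ℝ) + 1)⁻¹ * ∑ k, G k w ∂P) ^ 2 ∂P ≤
        (|A| + |B|) / ((N : ℝ) + 1) := by
  have hnpos : (0 : ℝ) < (N : ℝ) + 1 := by positivity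
  have hn0 : ((N : ℝ) + 1) ≠ 0 := hnpos.ne'
  -- the mean of the average is the average of the means
  have hmean : ∫ w, ((N : ℝ) + 1)⁻¹ * ∑ k, G k w ∂P = ((N : ℝ) + 1)⁻¹ * ∑ k, ∫ w, G k w ∂P := by
    rw [integral_const_mul, integral_finsetSum _ fun k _ => hint k]
  -- pointwise: the deviation of the average is the average of the deviations
  have hdev : ∀ z, ((N : ℝ) + 1)⁻¹ * ∑ k, G k z - ∫ w, ((N : ℝ) + 1)⁻¹ * ∑ k, G k w ∂P =
      ((N : ℝ) + 1)⁻¹ * ∑ k, (G k z - ∫ w, G k w ∂P) := by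
    intro z
    rw [hmean, Finset.sum_sub_distrib, mul_sub]
  -- pointwise: square of the average deviation = (N+1)⁻² (diagonal + off-diagonal)
  have hfun : (fun z => (((N : ℝ) + 1)⁻¹ * ∑ k, G k z - ∫ w, ((N : ℝ) + 1)⁻¹ * ∑ k, G k w ∂P) ^ 2) =
      fun z => ((N : ℝ) + 1)⁻¹ ^ 2 * ((∑ k, (G k z - ∫ w, G k w ∂P) ^ 2) +
        ∑ i, ∑ k ∈ Finset.univ.erase i, (G i z - ∫ w, G i w ∂P) * (G k z - ∫ w, G k w ∂P)) := by
    funext z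
    rw [hdev z, mul_pow, sq_sum_eq_diag_add_offDiag]
  -- integrability of the diagonal and off-diagonal parts
  have hD : Integrable (fun z => ∑ k, (G k z - ∫ w, G k w ∂P) ^ 2) P :=
    integrable_finsetSum _ fun k _ => hsq k
  have hOi : ∀ i, Integrable
      (fun z => ∑ k ∈ Finset.univ.erase i, (G i z - ∫ w, G i w ∂P) * (G k z - ∫ w, G k w ∂P)) P :=
    fun i => integrable_finsetSum _ fun k hk => hprod i k (Finset.ne_of_mem_erase hk).symm
  have hO : Integrable (fun z => ∑ i, ∑ k ∈ Finset.univ.erase i,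
      (G i z - ∫ w, G i w ∂P) * (G k z - ∫ w, G k w ∂P)) P :=
    integrable_finsetSum _ fun i _ => hOi i
  refine ⟨?_, ?_⟩
  · rw [hfun]
    exact (hD.add hO).const_mul _
  · rw [hfun, integral_const_mul, integral_add hD hO, integral_finsetSum _ fun k _ => hsq k,
      integral_finsetSum _ fun i _ => hOi i]
    -- diagonal: label-summed one-body second moments
    have hD_le : ∑ k, ∫ z, (G k z - ∫ w, G k w ∂P) ^ 2 ∂P ≤ |A| * ((N : ℝ) + 1) :=
      hdiag.trans (mul_le_mul_of_nonneg_right (le_abs_self A) hnpos.le)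
    -- off-diagonal: (N+1)·N pair covariances, each ≤ |B|/(N+1)
    have hO_le : ∑ i, ∫ z, ∑ k ∈ Finset.univ.erase i,
        (G i z - ∫ w, G i w ∂P) * (G k z - ∫ w, G k w ∂P) ∂P ≤ ((N : ℝ) + 1) * |B| := by
      calc ∑ i, ∫ z, ∑ k ∈ Finset.univ.erase i,
            (G i z - ∫ w, G i w ∂P) * (G k z - ∫ w, G k w ∂P) ∂P
          = ∑ i, ∑ k ∈ Finset.univ.erase i,
              ∫ z, (G i z - ∫ w, G i w ∂P) * (G k z - ∫ w, G k w ∂P) ∂P :=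
            Finset.sum_congr rfl fun i _ =>
              integral_finsetSum _ fun k hk => hprod i k (Finset.ne_of_mem_erase hk).symm
        _ ≤ ∑ _i : Fin (N + 1), ∑ _k : Fin (N + 1), |B| / ((N : ℝ) + 1) := by
            refine Finset.sum_le_sum fun i _ => ?_
            calc ∑ k ∈ Finset.univ.erase i,
                  ∫ z, (G i z - ∫ w, G i w ∂P) * (G k z - ∫ w, G k w ∂P) ∂P
                ≤ ∑ _k ∈ Finset.univ.erase i, |B| / ((N : ℝ) + 1) :=
                  Finset.sum_le_sum fun k hk => (le_abs_self _).trans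
                    ((hcov i k (Finset.ne_of_mem_erase hk).symm).trans
                      (div_le_div_of_nonneg_right (le_abs_self B) hnpos.le))
              _ ≤ ∑ _k : Fin (N + 1), |B| / ((N : ℝ) + 1) :=
                  Finset.sum_le_sum_of_subset_of_nonneg (Finset.erase_subset _ _)
                    fun _ _ _ => div_nonneg (abs_nonneg B) hnpos.le
        _ = ((N : ℝ) + 1) * |B| := by
            simp only [Finset.sum_const, Finset.card_univ, Fintype.card_fin, nsmul_eq_mul]
            push_cast
            field_simp
    calc ((N : ℝ) + 1)⁻¹ ^ 2 * (∑ k, ∫ z, (G k z - ∫ w, G k w ∂P) ^ 2 ∂P +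
          ∑ i, ∫ z, ∑ k ∈ Finset.univ.erase i,
            (G i z - ∫ w, G i w ∂P) * (G k z - ∫ w, G k w ∂P) ∂P)
        ≤ ((N : ℝ) + 1)⁻¹ ^ 2 * (|A| * ((N : ℝ) + 1) + ((N : ℝ) + 1) * |B|) :=
          mul_le_mul_of_nonneg_left (add_le_add hD_le hO_le) (by positivity)
      _ = (|A| + |B|) / ((N : ℝ) + 1) := by
          field_simp

/-! ## The composition (kernel-checked; no `sorry` of its own) -/

/-- **`CLTScaleConcentration` from the two stubs BY NAME** (conclusion literally the route decl
`Summit.AtomisticToContinuum.HydrodynamicLimit.Theses.ResponseRigidity.CLTScaleConcentration`).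
Proof: thresholds `η := min η₁ η₂`, `σ₀ := min σ₁ σ₂`; for `(t, χ)` take `C := |C₁| + |C₂|`; for
`(N, s, τ, F)` recognise the tested field `F` as the label average `(N+1)⁻¹ ∑ₖ g(zₖ(s))` of the
one-body observable `g ∈ {χ(x), χ(x)vⱼ, χ(x)|v|²/2}` (`empirical*Field_eq_sum`) and apply the
second-moment expansion `variance_avg_le` to the one-body data (stub 1) and the pair data (stub 2). -/
theorem CLTScaleConcentration_of :
    (open Literature.MathematicalPhysics.KineticTheory Literature.Analysis.FluidPDE in ∃ η : ℝ, 0 < η ∧ ∀ (a₀ θ₀ : T3 → ℝ) (u₀ : T3 → V3), Continuous a₀ → Continuous θ₀ → Continuous u₀ → (∀ x, 0 < a₀ x) → (∀ x, 0 < θ₀ x) → ∃ σ₀ : ℝ, 0 < σ₀ ∧ ∀ σ : ℝ, 0 < σ → σ < σ₀ → ∀ (T : ℝ) (ρ θ : ℝ → T3 → ℝ) (u : ℝ → T3 → V3), IsHardSphereEulerSolution σ T ρ u θ → (∀ t ∈ Set.Ico 0 T, ∀ x, ρ t x * σ ^ 3 < η) → ∀ Φ : (N : ℕ) → HardSphereFlow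 (Torus.geometry (Fin 3)) (hsDiameter σ N) (N + 1), TendstoHydroFieldsAt (fun N => localGibbsLaw σ a₀ u₀ θ₀ N (Φ N)) Φ ρ u θ 0 → ∀ a : ℝ → T3 → ℝ, a 0 = a₀ → (∀ τ ∈ Set.Ico 0 T, Continuous (a τ) ∧ ∀ x, 0 < a τ x) → (∀ τ ∈ Set.Ico 0 T, ∀ χ : T3 → ℝ, Literature.Analysis.FunctionSpaces.Torus.IsSmooth χ → Tendsto (fun N : ℕ => ∫ z, empiricalDensityField z χ ∂(localGibbsLaw σ (a τ) (u τ) (θ τ) N (Φ N))) atTop (𝓝 (∫ x, χ x * ρ τ x)) ∧ (∀ j : Fin 3, Tendsto (fun N : ℕ => ∫ z, empiricalMomentumField z χ j ∂(localGibbsLaw σ (a τ) (u τ) (θ τ) N (Φ N))) atTop (𝓝 (∫ x, χ x * ρ τ x * u τ x j))) ∧ Tendsto (fun N : ℕ => ∫ z, empiricalEnergyField z χ ∂(localGibbsLaw σ (a τ) (u τ) (θ τ) N (Φ N))) atTop (𝓝 (∫ x, χ x * totalEnergyDensity (ρ τ x) (u τ x) (θ τ x)))) → ∀ t ∈ Set.Ico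 0 T, ∀ χ : T3 → ℝ, Literature.Analysis.FunctionSpaces.Torus.IsSmooth χ → ∃ C₁ : ℝ, ∀ N : ℕ, ∀ s τ : ℝ, 0 ≤ s → 0 ≤ τ → s + τ ≤ t → let P : Measure (Config (N + 1) (Fin 3) T3) := localGibbsLaw σ (a τ) (u τ) (θ τ) N (Φ N); ∀ g : T3 × V3 → ℝ, ((g = fun y => χ y.1) ∨ (∃ j : Fin 3, g = fun y => χ y.1 * y.2 j) ∨ (g = fun y => χ y.1 * (‖y.2‖ ^ 2 / 2))) → (∀ k : Fin (N + 1), Integrable (fun z => g ((Φ N).flow s z k)) P ∧ Integrable (fun z => (g ((Φ N).flow s z k) - ∫ w, g ((Φ N).flow s w k) ∂P) ^ 2) P) ∧ ∑ k : Fin (N + 1), ∫ z, (g ((Φ N).flow s z k) - ∫ w, g ((Φ N).flow s w k) ∂P) ^ 2 ∂P ≤ C₁ * ((N : ℝ) + 1)) →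
    (open Literature.MathematicalPhysics.KineticTheory Literature.Analysis.FluidPDE in ∃ η : ℝ, 0 < η ∧ ∀ (a₀ θ₀ : T3 → ℝ) (u₀ : T3 → V3), Continuous a₀ → Continuous θ₀ → Continuous u₀ → (∀ x, 0 < a₀ x) → (∀ x, 0 < θ₀ x) → ∃ σ₀ : ℝ, 0 < σ₀ ∧ ∀ σ : ℝ, 0 < σ → σ < σ₀ → ∀ (T : ℝ) (ρ θ : ℝ → T3 → ℝ) (u : ℝ → T3 → V3), IsHardSphereEulerSolution σ T ρ u θ → (∀ t ∈ Set.Ico 0 T, ∀ x, ρ t x * σ ^ 3 < η) → ∀ Φ : (N : ℕ) → HardSphereFlow (Torus.geometry (Fin 3)) (hsDiameter σ N) (N + 1), TendstoHydroFieldsAt (fun N => localGibbsLaw σ a₀ u₀ θ₀ N (Φ N)) Φ ρ u θ 0 → ∀ a : ℝ → T3 → ℝ, a 0 = a₀ → (∀ τ ∈ Set.Ico 0 T, Continuous (a τ) ∧ ∀ x, 0 < a τ x) → (∀ τ ∈ Set.Ico 0 T, ∀ χ : T3 → ℝ, Literature.Analysis.FunctionSpaces.Torus.IsSmooth χ → Tendsto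 (fun N : ℕ => ∫ z, empiricalDensityField z χ ∂(localGibbsLaw σ (a τ) (u τ) (θ τ) N (Φ N))) atTop (𝓝 (∫ x, χ x * ρ τ x)) ∧ (∀ j : Fin 3, Tendsto (fun N : ℕ => ∫ z, empiricalMomentumField z χ j ∂(localGibbsLaw σ (a τ) (u τ) (θ τ) N (Φ N))) atTop (𝓝 (∫ x, χ x * ρ τ x * u τ x j))) ∧ Tendsto (fun N : ℕ => ∫ z, empiricalEnergyField z χ ∂(localGibbsLaw σ (a τ) (u τ) (θ τ) N (Φ N))) atTop (𝓝 (∫ x, χ x * totalEnergyDensity (ρ τ x) (u τ x) (θ τ x)))) → ∀ t ∈ Set.Ico 0 T, ∀ χ : T3 → ℝ, Literature.Analysis.FunctionSpaces.Torus.IsSmooth χ → ∃ C₂ : ℝ, ∀ N : ℕ, ∀ s τ : ℝ, 0 ≤ s → 0 ≤ τ → s + τ ≤ t → let P : Measure (Config (N + 1) (Fin 3) T3) := localGibbsLaw σ (a τ) (u τ) (θ τ) N (Φ N); ∀ g : T3 × V3 → ℝ, ((g = fun y => χ y.1) ∨ (∃ j : Fin 3, g = fun y => χ y.1 * y.2 j)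 ∨ (g = fun y => χ y.1 * (‖y.2‖ ^ 2 / 2))) → ∀ i k : Fin (N + 1), i ≠ k → Integrable (fun z => (g ((Φ N).flow s z i) - ∫ w, g ((Φ N).flow s w i) ∂P) * (g ((Φ N).flow s z k) - ∫ w, g ((Φ N).flow s w k) ∂P)) P ∧ |∫ z, (g ((Φ N).flow s z i) - ∫ w, g ((Φ N).flow s w i) ∂P) * (g ((Φ N).flow s z k) - ∫ w, g ((Φ N).flow s w k) ∂P) ∂P| ≤ C₂ / ((N : ℝ) + 1)) →
    Summit.AtomisticToContinuum.HydrodynamicLimit.Theses.ResponseRigidity.CLTScaleConcentration := by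
  intro hOne hPair
  obtain ⟨η₁, hη₁, H₁⟩ := hOne
  obtain ⟨η₂, hη₂, H₂⟩ := hPair
  refine ⟨min η₁ η₂, lt_min hη₁ hη₂, ?_⟩
  intro a₀ θ₀ u₀ ha hθ hu ha0 hθ0
  obtain ⟨σ₁, hσ₁, K₁⟩ := H₁ a₀ θ₀ u₀ ha hθ hu ha0 hθ0
  obtain ⟨σ₂, hσ₂, K₂⟩ := H₂ a₀ θ₀ u₀ ha hθ hu ha0 hθ0
  refine ⟨min σ₁ σ₂, lt_min hσ₁ hσ₂, ?_⟩
  intro σ hσ hσ' T ρ θ u hsol hpack Φ h0 a ha0' hapos hmeans t ht χ hχ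
  have h1 : σ < σ₁ := lt_of_lt_of_le hσ' (min_le_left _ _)
  have h2 : σ < σ₂ := lt_of_lt_of_le hσ' (min_le_right _ _)
  have hp1 : ∀ t' ∈ Set.Ico 0 T, ∀ x, ρ t' x * σ ^ 3 < η₁ :=
    fun t' ht' x => lt_of_lt_of_le (hpack t' ht' x) (min_le_left _ _)
  have hp2 : ∀ t' ∈ Set.Ico 0 T, ∀ x, ρ t' x * σ ^ 3 < η₂ :=
    fun t' ht' x => lt_of_lt_of_le (hpack t' ht' x) (min_le_right _ _)
  obtain ⟨C₁, hC₁⟩ := K₁ σ hσ h1 T ρ θ u hsol hp1 Φ h0 a ha0' hapos hmeans t ht χ hχ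
  obtain ⟨C₂, hC₂⟩ := K₂ σ hσ h2 T ρ θ u hsol hp2 Φ h0 a ha0' hapos hmeans t ht χ hχ
  refine ⟨|C₁| + |C₂|, ?_⟩
  intro N s τ hs hτ hst
  dsimp only
  intro F hF
  -- the three tested conserved fields at time `s` are label averages of a one-body observable `g`
  obtain ⟨g, hg, hFg⟩ : ∃ g : T3 × V3 → ℝ,
      ((g = fun y => χ y.1) ∨ (∃ j : Fin 3, g = fun y => χ y.1 * y.2 j) ∨
        (g = fun y => χ y.1 * (‖y.2‖ ^ 2 / 2))) ∧
      F = fun z => ((N : ℝ) + 1)⁻¹ * ∑ k, g ((Φ N).flow s z k) := by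
    rcases hF with hF | ⟨j, hF⟩ | hF
    · refine ⟨fun y => χ y.1, Or.inl rfl, ?_⟩
      rw [hF]
      funext z
      simp only [empiricalDensityField_eq_sum, Nat.cast_add, Nat.cast_one]
    · refine ⟨fun y => χ y.1 * y.2 j, Or.inr (Or.inl ⟨j, rfl⟩), ?_⟩
      rw [hF]
      funext z
      simp only [empiricalMomentumField_apply_eq_avg, Nat.cast_add, Nat.cast_one]
    · refine ⟨fun y => χ y.1 * (‖y.2‖ ^ 2 / 2), Or.inr (Or.inr rfl), ?_⟩
      rw [hF]
      funext z
      simp only [empiricalEnergyField_eq_sum, Nat.cast_add, Nat.cast_one]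
  subst hFg
  have hA := hC₁ N s τ hs hτ hst g hg
  have hB := hC₂ N s τ hs hτ hst g hg
  exact variance_avg_le _ (fun k z => g ((Φ N).flow s z k)) C₁ C₂
    (fun k => (hA.1 k).1) (fun k => (hA.1 k).2) hA.2
    (fun i k hik => (hB i k hik).1) (fun i k hik => (hB i k hik).2)

/-- The crux from the two registered stubs BY NAME (its axiom closure contains `sorryAx` exactly through
`stub_oneBodyMoments` and `stub_pairCumulant`; no `sorry` of its own). -/
theorem CLTScaleConcentration_of_stubs :
    Summit.AtomisticToContinuum.HydrodynamicLimit.Theses.ResponseRigidity.CLTScaleConcentration :=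
  CLTScaleConcentration_of stub_oneBodyMoments stub_pairCumulant

end Summit.AtomisticToContinuum.HydrodynamicLimit.Cruxes.CLTScaleConcentration.Birth

end
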